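import Summits.QuantumFields.YangMills.Theorems.ToronSmallBallSiteTwist
import HarnessLib

/-!
# Configuration-dependent sheet translates preserve the a-priori measure when the translate elements do not depend on the translated links

Support module for the translate cruxes of seat ym-idea-4's LINE g12-A/B (`ToronSmallBall.ToronCoreRaritySubQuartic` ⟨stmt-QuantumFields-23956⟩ cases (α)/(γ),
`OffCoreStripWindowDeep` ⟨23957⟩, `QuantileBitPurity.HolonomyQuantileSubQuartic` ⟨23948⟩; memo HOME `bc/g12-A/PLAN-X1-v2-gauss.md` §2, last paragraph:
«MEASURE PRESERVATION (product Haar): in (α) `h(s)` depends on plane (y,z) links, not on the shifted x-sheet links … in all cases the shift of the sheet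
x-links is a fibrewise left translation ⇒ Haar-invariant by Fubini»).  We prove exactly this Fubini statement for the tree's `siteTwist`:

★ `measurePreserving_siteTwist_of_indep` — if `hf : GaugeConfig 3 L G → (Site 3 L → G)` is measurable and `hf U` depends only on the links of `U` OFF the
plane sheet `{(x, k) : x_k = 0}`, then `U ↦ siteTwist k (hf U) U` preserves `configMeasure G L`.

Proof: split the product Haar measure along sheet/non-sheet links (`MeasurableEquiv.piEquivPiSubtypeProd`, `measurePreserving_piEquivPiSubtypeProd`); in these
coordinates the map is a skew product over the identity of the non-sheet factor whose fibre maps are products of left translations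
(`MeasurePreserving.skew_product`, `measurePreserving_pi`, `measurePreserving_mul_left`).
HONEST FRAMING: a change-of-variables lemma on a finite product of compact groups; nothing about infinite volume, the continuum limit or the Clay gap.
No `sorry`, no new axiom, no new definition.  References: [cite: Luscher1983, §2]; [cite: tHooft1979].
-/

set_option autoImplicit false

noncomputable section

open MeasureTheory
open Literature.MathematicalPhysics.QuantumFieldTheory
open Literature.MathematicalPhysics.QuantumLattice

namespace Summit.QuantumFields.YangMills.Theorems.FemtoTransferGap

variable {G : Type*} [Group G] [MeasurableSpace G] [TopologicalSpace G] [IsTopologicalGroup G] [BorelSpace G] [CompactSpace G]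
  {L : ℕ} [NeZero L]

set_option maxHeartbeats 800000 in
/-- ★ **Fibrewise left translations preserve the product Haar measure.**  Let `hf : GaugeConfig 3 L G → (Site 3 L → G)` be measurable and INDEPENDENT of
the sheet links: `hf U = hf V` whenever `U` and `V` agree off `{(x, k) : x_k = 0}`.  Then the configuration-dependent sheet translate
`U ↦ siteTwist k (hf U) U` preserves `configMeasure G L` (Fubini over the non-sheet links, left invariance of Haar on each sheet link; `G` second
countable so that multiplication is jointly measurable — e.g. `SU(2)` via the tree's `secondCountableTopology_su2`). [cite: Luscher1983, §2] -/
theorem measurePreserving_siteTwist_of_indep [SecondCountableTopology G] (k : Fin 3) {hf : GaugeConfig 3 L G → Site 3 L → G} (hm : Measurable hf)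
    (hind : ∀ U V : GaugeConfig 3 L G, (∀ e : Edge 3 L, ¬ (e.2 = k ∧ e.1 k = 0) → U e = V e) → hf U = hf V) :
    MeasurePreserving (fun U => siteTwist k (hf U) U) (configMeasure G L) (configMeasure G L) := by
  classical
  -- sheet / non-sheet splitting of the product Haar measure
  let p : Edge 3 L → Prop := fun e => e.2 = k ∧ e.1 k = 0
  let μ : Edge 3 L → Measure G := fun _ => haarProbability G
  let φ : GaugeConfig 3 L G ≃ᵐ ({e // p e} → G) × ({e // ¬ p e} → G) := MeasurableEquiv.piEquivPiSubtypeProd (fun _ : Edge 3 L => G) p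
  have hφ : MeasurePreserving φ (configMeasure G L)
      ((Measure.pi fun i : {e // p e} => μ i).prod (Measure.pi fun i : {e // ¬ p e} => μ i)) :=
    measurePreserving_piEquivPiSubtypeProd μ p
  -- the translate elements as a function of the non-sheet links
  let ext : ({e // ¬ p e} → G) → GaugeConfig 3 L G := fun uR => φ.symm (fun _ => 1, uR)
  let H : ({e // ¬ p e} → G) → Site 3 L → G := fun uR => hf (ext uR)
  have hext_m : Measurable ext := φ.symm.measurable.comp (measurable_const.prodMk measurable_id)
  have hH : Measurable H := hm.comp hext_m
  have hHU : ∀ U : GaugeConfig 3 L G, hf U = H (φ U).2 := fun U => by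
    refine hind U (ext (φ U).2) fun e he => ?_
    show U e = (Equiv.piEquivPiSubtypeProd p (fun _ : Edge 3 L => G)).symm (fun _ => 1, (φ U).2) e
    rw [Equiv.piEquivPiSubtypeProd_symm_apply, dif_neg he]
    rfl
  -- the skew product on the split coordinates (non-sheet factor first)
  let g : ({e // ¬ p e} → G) → ({e // p e} → G) → ({e // p e} → G) := fun uR uS i => H uR i.1.1 * uS i
  have hgm : Measurable (Function.uncurry g) := by
    refine measurable_pi_lambda _ fun i => ?_
    have h1 : Measurable fun q : ({e // ¬ p e} → G) × ({e // p e} → G) => H q.1 i.1.1 :=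
      (measurable_pi_apply i.1.1).comp (hH.comp measurable_fst)
    have h2 : Measurable fun q : ({e // ¬ p e} → G) × ({e // p e} → G) => q.2 i := (measurable_pi_apply i).comp measurable_snd
    exact h1.mul h2
  have hg : ∀ uR, Measure.map (g uR) (Measure.pi fun i : {e // p e} => μ i) = Measure.pi fun i : {e // p e} => μ i := fun uR =>
    (measurePreserving_pi (fun i : {e // p e} => μ i) (fun i : {e // p e} => μ i) (f := fun i (x : G) => H uR i.1.1 * x)
      fun i => measurePreserving_mul_left (haarProbability G) (H uR i.1.1)).map_eq
  have hΨ : MeasurePreserving (fun q : ({e // ¬ p e} → G) × ({e // p e} → G) => (q.1, g q.1 q.2))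
      ((Measure.pi fun i : {e // ¬ p e} => μ i).prod (Measure.pi fun i : {e // p e} => μ i))
      ((Measure.pi fun i : {e // ¬ p e} => μ i).prod (Measure.pi fun i : {e // p e} => μ i)) :=
    MeasurePreserving.skew_product (f := id) (MeasurePreserving.id _) hgm (Filter.Eventually.of_forall hg)
  -- the translate is the conjugate of the skew product
  have hT : (fun U => siteTwist k (hf U) U) =
      φ.symm ∘ Prod.swap ∘ (fun q : ({e // ¬ p e} → G) × ({e // p e} → G) => (q.1, g q.1 q.2)) ∘ Prod.swap ∘ φ := by
    funext U
    funext e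
    simp only [Function.comp_apply, Prod.swap_prod_mk]
    show siteTwist k (hf U) U e = (Equiv.piEquivPiSubtypeProd p (fun _ : Edge 3 L => G)).symm ((φ U).1 |> fun uS => g (φ U).2 uS, (φ U).2) e
    rw [Equiv.piEquivPiSubtypeProd_symm_apply]
    by_cases he : p e
    · rw [dif_pos he, siteTwist_apply, if_pos he, hHU U]
      rfl
    · rw [dif_neg he, siteTwist_apply, if_neg he]
      rfl
  rw [hT]
  exact hφ.symm.comp (Measure.measurePreserving_swap.comp (hΨ.comp (Measure.measurePreserving_swap.comp hφ)))

omit [MeasurableSpace G] [TopologicalSpace G] [IsTopologicalGroup G] [BorelSpace G] [CompactSpace G] [NeZero L] in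
/-- The independence hypothesis in the usable form: if `hf` factors through the restriction to non-sheet links, i.e. `hf U` only reads links `U e` with
`¬(e.2 = k ∧ e.1 k = 0)`, it is in particular invariant under every site-dependent sheet translate: `hf (siteTwist k h U) = hf U`. [folklore] -/
theorem indep_siteTwist {k : Fin 3} {hf : GaugeConfig 3 L G → Site 3 L → G}
    (hind : ∀ U V : GaugeConfig 3 L G, (∀ e : Edge 3 L, ¬ (e.2 = k ∧ e.1 k = 0) → U e = V e) → hf U = hf V)
    (h : Site 3 L → G) (U : GaugeConfig 3 L G) : hf (siteTwist k h U) = hf U :=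
  hind _ _ fun e he => by rw [siteTwist_apply, if_neg he]

end Summit.QuantumFields.YangMills.Theorems.FemtoTransferGap

end
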